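import Mathlib
import Literature.NumberTheory.LFunctions.WeilGroundState
import Literature.NumberTheory.LFunctions.WeilGroundStateRealZerosProofs
import Summits.RiemannHypothesis.RiemannHypothesis.Theorems.WeilGroundStateGroundStatesConvergeToXiEulerLagrange
import HarnessLib

/-!
# Crux `GroundStateSimpleEven` (stmt-RiemannHypothesis-1526), line `parity-multiplicity-commutator`,
# stub INTERTWINE — helper 2: parity, the kernel identity `v' ⋆ ψ̃ = −v ⋆ (ψ')̃`, primitives

Support file (`--supports stmt-RiemannHypothesis-1526`) for the stub
`stub_oddMinimisers_of_edgeCancelledPair`.  Normalisation of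
`Literature/NumberTheory/LFunctions/WeilExplicit.lean`: `W = weilFunctional`, `Q g = W(g ⋆ g̃)`,
`g̃ = weilReflect g`, `⋆ = weilConv`, `ε(a) = weilGroundEnergy a`,
`q(f) = Re Q(f) − ε(a)∫|f|²` (non-negative on window test functions).

## Contents (everything proved; Mathlib + proved tree files only)

* §1 **Parity.** `W` is reflection invariant and kills odd kernels (Connes–Consani 2023 §2.1.3,
  Lemma 2.5 (iii)); hence the shifted form of the odd part of a window test function is bounded by
  that of the function: `q(gₒ) ≤ q(g)`, `gₒ = ½(g − g(-·))` (`shiftedForm_oddPart_le`).  The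
  reflection identities are private re-derivations of §0 of `WeilGroundStateRealZerosProofs.lean`
  (its public twin `WeilWindowSimpleEven.lean` cannot be imported next to it).
* §2 **The kernel identity** (continuum Connes–van Suijlekom Lemma 5.1 without boundary term):
  for test functions `v, ψ`, `v' ⋆ ψ̃ = −(v ⋆ (ψ')̃)` as functions, so
  `W(v' ⋆ ψ̃) = −W(v ⋆ (ψ')̃)` and, at `t = 0`, `∫ v' conj ψ = −∫ v conj ψ'`.
* §3 **Primitives of window functions.** For `v ∈ L²` vanishing a.e. off `[-a, a]` with `∫ v = 0`
  the primitive `t ↦ ∫_{-a}^t v` vanishes off the window and `∫ |∫_{-a}^t v|² dt ≤ 4a² ∫|v|²`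
  (Cauchy–Schwarz); a mean-zero window test function has a window test primitive
  (`ConnesVanSuijlekom.exists_primitive` at `w = 0`).

No definitions, no named facts.
-/

noncomputable section

open Set MeasureTheory Filter Complex
open scoped Real Topology ComplexConjugate

namespace Summit.RiemannHypothesis.RiemannHypothesis.Theorems.GroundStateSimpleEven

open Literature.NumberTheory.LFunctions
open Summit.RiemannHypothesis.RiemannHypothesis.Theorems.GroundStatesConvergeToXi

-- `linter.dupNamespace` off: the mandated namespace `Summit.RiemannHypothesis.RiemannHypothesis.…`
-- (single-problem summit) repeats a component.
set_option linter.dupNamespace false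

/-! ## §1. Parity: `W` kills odd kernels; `q(gₒ) ≤ q(g)` -/

section Parity

variable {a : ℝ} {g k e o : ℝ → ℂ}

-- adapted from Literature/NumberTheory/LFunctions/WeilGroundStateRealZerosProofs.lean (§0, private)
/-- Reflection commutes with convolution: `(g(-·)) ⋆ (h(-·)) = (g ⋆ h)(-·)`. [folklore] -/
private theorem weilConv_comp_neg_aux (g h : ℝ → ℂ) :
    weilConv (fun t ↦ g (-t)) (fun t ↦ h (-t)) = fun t ↦ weilConv g h (-t) := by
  funext t
  rw [weilConv_apply, weilConv_apply,
    ← integral_neg_eq_self (fun u : ℝ ↦ g u * h (-t - u)) volume]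
  congr 1 with u
  rw [show -(t - u) = -t - -u by ring]

-- adapted from Literature/NumberTheory/LFunctions/WeilGroundStateRealZerosProofs.lean (§0, private)
/-- **Reflection invariance of the Weil functional**: `W(k(-·)) = W(k)` for every `k : ℝ → ℂ`
(`(k(-·))^(s) = k̂(1-s)`, the prime term only sees `k(log n) + k(-log n)`, and
`Re ψ(1/4 + it/2)` is even in `t`); hypothesis-free. [folklore] -/
private theorem weilFunctional_comp_neg_aux (k : ℝ → ℂ) :
    weilFunctional (fun t ↦ k (-t)) = weilFunctional k := by
  have hP : weilPolarTerm (fun t ↦ k (-t)) = weilPolarTerm k := by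
    rw [weilPolarTerm, weilPolarTerm, weilMellin_comp_neg, weilMellin_comp_neg, sub_zero, sub_self,
      add_comm]
  have hPr : weilPrimeTerm (fun t ↦ k (-t)) = weilPrimeTerm k := by
    unfold weilPrimeTerm
    refine tsum_congr fun n ↦ ?_
    dsimp only
    rw [neg_neg, add_comm (k (-Real.log n))]
  have hAI : weilArchIntegral (fun t ↦ k (-t)) = weilArchIntegral k := by
    unfold weilArchIntegral
    rw [← integral_neg_eq_self (fun t : ℝ ↦ weilMellin k (1 / 2 + t * I) *
      ((Complex.digamma (1 / 4 + t / 2 * I)).re : ℂ)) volume]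
    congr 1 with t
    rw [weilMellin_comp_neg, quarter_add_neg_mul_I, digamma_conj, Complex.conj_re]
    congr 2
    push_cast
    ring
  have hA : weilArchTerm (fun t ↦ k (-t)) = weilArchTerm k := by
    rw [weilArchTerm, weilArchTerm, hAI, neg_zero]
  rw [weilFunctional, weilFunctional, hP, hPr, hA]

/-- **`W` vanishes on odd functions**: `k(-t) = -k(t)` for all `t` implies `W(k) = 0`
(`W(k) = W(k(-·)) = W(-k) = -W(k)`; Connes–Consani 2023 §2.1.3, Lemma 2.5 (iii)). [folklore] -/
private theorem weilFunctional_eq_zero_of_odd_aux (hodd : ∀ t, k (-t) = -k t) :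
    weilFunctional k = 0 := by
  have h1 : (fun t ↦ k (-t)) = fun t ↦ (-1 : ℂ) * k t := funext fun t ↦ by rw [hodd, neg_one_mul]
  have h := weilFunctional_comp_neg_aux k
  rw [h1, weilFunctional_const_mul] at h
  linear_combination (-1 / 2 : ℂ) * h

/-- For `e` even and `o` odd both cross kernels `e ⋆ õ` and `o ⋆ ẽ` are odd functions, hence
`W(e ⋆ õ) + W(o ⋆ ẽ) = 0`. [folklore] -/
theorem weilFunctional_cross_eq_zero_of_even_odd (he : ∀ t, e (-t) = e t)
    (ho : ∀ t, o (-t) = -o t) :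
    weilFunctional (weilConv e (weilReflect o)) + weilFunctional (weilConv o (weilReflect e)) = 0 := by
  have h1 : (fun t ↦ e (-t)) = e := funext he
  have h2 : (fun t ↦ o (-t)) = fun t ↦ (-1 : ℂ) * o t := funext fun t ↦ by rw [ho, neg_one_mul]
  have hRo : weilReflect (fun t ↦ (-1 : ℂ) * o t) = fun t ↦ (-1 : ℂ) * weilReflect o t := by
    funext t
    simp [weilReflect]
  have hL : weilConv (fun t ↦ (-1 : ℂ) * o t) (weilReflect e) =
      fun t ↦ (-1 : ℂ) * weilConv o (weilReflect e) t := by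
    funext t
    rw [weilConv_apply, weilConv_apply, ← integral_const_mul]
    congr 1 with u
    ring
  have hodd₁ : (fun t ↦ weilConv e (weilReflect o) (-t)) =
      fun t ↦ (-1 : ℂ) * weilConv e (weilReflect o) t := by
    rw [← weilConv_comp_neg_aux, show (fun t ↦ weilReflect o (-t)) = weilReflect fun t ↦ o (-t)
      from rfl, h1, h2, hRo, weilConv_const_mul_right']
  have hodd₂ : (fun t ↦ weilConv o (weilReflect e) (-t)) =
      fun t ↦ (-1 : ℂ) * weilConv o (weilReflect e) t := by
    rw [← weilConv_comp_neg_aux, show (fun t ↦ weilReflect e (-t)) = weilReflect fun t ↦ e (-t)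
      from rfl, h1, h2, hL]
  rw [weilFunctional_eq_zero_of_odd_aux fun t ↦ by simpa using congr_fun hodd₁ t,
    weilFunctional_eq_zero_of_odd_aux fun t ↦ by simpa using congr_fun hodd₂ t, add_zero]

/-- The odd part `½(g - g(-·))` of a test function is a test function. [folklore] -/
theorem isWeilTest_oddPart' (hg : IsWeilTest g) : IsWeilTest fun t ↦ (g t - g (-t)) / 2 := by
  convert (hg.add (hg.comp_neg.const_mul (-1))).const_mul (1 / 2) using 1
  funext t; simp only [Pi.add_apply]; ring

/-- The odd part of a function on the symmetric window lives on the window. [folklore] -/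
theorem tsupport_oddPart_subset (hgs : tsupport g ⊆ Icc (-a) a) :
    tsupport (fun t ↦ (g t - g (-t)) / 2) ⊆ Icc (-a) a := by
  have h := ConnesVanSuijlekom.tsupport_evenPart_subset hgs (-1)
  convert h using 3
  ring

/-- **Parity splitting of `Re Q`**: `Re Q(g) = Re Q(½(g + g(-·))) + Re Q(½(g − g(-·)))` for a
test function `g` (expansion of `Re Q` along the line `gₑ + t gₒ` at `t = 1`,
`ConnesVanSuijlekom.re_weilQuadratic_add_real_mul`, the cross kernels being odd;
Connes–Consani 2023 §2.1.3, `QW = QW⁺ ⊕ QW⁻`). [folklore] -/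
theorem re_weilQuadratic_eq_re_evenPart_add_re_oddPart (hg : IsWeilTest g) :
    (weilQuadratic g).re =
      (weilQuadratic fun t ↦ (g t + g (-t)) / 2).re +
        (weilQuadratic fun t ↦ (g t - g (-t)) / 2).re := by
  have hge : IsWeilTest fun t ↦ (g t + g (-t)) / 2 := by
    convert (hg.add hg.comp_neg).const_mul (1 / 2) using 1
    funext t; simp only [Pi.add_apply]; ring
  have hgo : IsWeilTest fun t ↦ (g t - g (-t)) / 2 := isWeilTest_oddPart' hg
  have hsum : g = (fun t ↦ (g t + g (-t)) / 2) + fun x ↦ ((1 : ℝ) : ℂ) * ((g x - g (-x)) / 2) := by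
    funext t
    simp only [Pi.add_apply, Complex.ofReal_one, one_mul]
    ring
  have hev : ∀ t, (fun t ↦ (g t + g (-t)) / 2) (-t) = (fun t ↦ (g t + g (-t)) / 2) t := fun t ↦ by
    simp only [neg_neg]; ring
  have hod : ∀ t, (fun t ↦ (g t - g (-t)) / 2) (-t) = -(fun t ↦ (g t - g (-t)) / 2) t := fun t ↦ by
    simp only [neg_neg]; ring
  conv_lhs => rw [hsum]
  rw [ConnesVanSuijlekom.re_weilQuadratic_add_real_mul hge hgo 1,
    weilFunctional_cross_eq_zero_of_even_odd hev hod]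
  simp

/-- **The odd part does not increase the shifted form**: for a window test function `g`,
`q(gₒ) ≤ q(g)` where `q(f) = Re Q(f) − ε(a)∫|f|²` and `gₒ = ½(g − g(-·))`: indeed
`q(g) = q(gₑ) + q(gₒ)` (parity splitting of `Re Q` and of `∫|·|²`) and `q(gₑ) ≥ 0`
(`ConnesVanSuijlekom.weilGroundEnergy_mul_le_re`). [folklore] -/
theorem shiftedForm_oddPart_le (hg : IsWeilTest g) (hgs : tsupport g ⊆ Icc (-a) a) :
    (weilQuadratic fun t ↦ (g t - g (-t)) / 2).re -
        weilGroundEnergy a * ∫ t, ‖(g t - g (-t)) / 2‖ ^ 2 ≤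
      (weilQuadratic g).re - weilGroundEnergy a * ∫ t, ‖g t‖ ^ 2 := by
  have hge : IsWeilTest fun t ↦ (g t + g (-t)) / 2 := by
    convert (hg.add hg.comp_neg).const_mul (1 / 2) using 1
    funext t; simp only [Pi.add_apply]; ring
  have hges : tsupport (fun t ↦ (g t + g (-t)) / 2) ⊆ Icc (-a) a := by
    have h := ConnesVanSuijlekom.tsupport_evenPart_subset hgs 1
    convert h using 3
    ring
  have hq := ConnesVanSuijlekom.weilGroundEnergy_mul_le_re hge hges
  rw [re_weilQuadratic_eq_re_evenPart_add_re_oddPart hg,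
    ConnesVanSuijlekom.integral_norm_sq_eq_evenPart_add_oddPart hg]
  nlinarith [hq]

end Parity

/-! ## §2. The kernel identity `v' ⋆ ψ̃ = −v ⋆ (ψ')̃` -/

section Kernel

variable {v ψ : ℝ → ℂ}

/-- **The kernel identity (`d/dt` intertwines).** For test functions `v, ψ`:
`v' ⋆ ψ̃ = −(v ⋆ (ψ')̃)` as functions, since `v' ⋆ ψ̃ = (v ⋆ ψ̃)' = v ⋆ (ψ̃)'` and
`(ψ')̃ = −(ψ̃)'`.  This is the continuum form of Connes–van Suijlekom 2025, Lemma 5.1 (5.2),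
with no boundary term (compact supports). [folklore] -/
theorem weilConv_deriv_weilReflect_eq_neg (hv : IsWeilTest v) (hψ : IsWeilTest ψ) :
    weilConv (deriv v) (weilReflect ψ) = fun t ↦ -weilConv v (weilReflect (deriv ψ)) t := by
  have h1 : weilConv (deriv v) (weilReflect ψ) = deriv (weilConv v (weilReflect ψ)) :=
    (ConnesVanSuijlekom.deriv_weilConv_left hv hψ.weilReflect.1.continuous).symm
  have h2 : deriv (weilConv v (weilReflect ψ)) = weilConv v (deriv (weilReflect ψ)) :=
    ConnesVanSuijlekom.deriv_weilConv_right hv.1.continuous hψ.weilReflect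
  have h3 : weilReflect (deriv ψ) = fun t ↦ (-1 : ℂ) * deriv (weilReflect ψ) t := by
    rw [ConnesVanSuijlekom.weilReflect_deriv]
    funext t
    ring
  rw [h1, h2, h3, weilConv_const_mul_right']
  funext t
  ring

/-- `W(v' ⋆ ψ̃) = −W(v ⋆ (ψ')̃)` for test functions `v, ψ` (the kernel identity and
`W(−k) = −W(k)`). [folklore] -/
theorem weilFunctional_weilConv_deriv_left (hv : IsWeilTest v) (hψ : IsWeilTest ψ) :
    weilFunctional (weilConv (deriv v) (weilReflect ψ)) =
      -weilFunctional (weilConv v (weilReflect (deriv ψ))) := by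
  rw [weilConv_deriv_weilReflect_eq_neg hv hψ,
    show (fun t ↦ -weilConv v (weilReflect (deriv ψ)) t) =
      fun t ↦ (-1 : ℂ) * weilConv v (weilReflect (deriv ψ)) t from funext fun t ↦ by ring,
    weilFunctional_const_mul]
  ring

/-- The polarised kernel at the origin is the `L²` pairing: `(g ⋆ h̃)(0) = ∫ g conj h`
(no hypotheses). [folklore] -/
theorem weilConv_weilReflect_apply_zero_eq_integral (g h : ℝ → ℂ) :
    weilConv g (weilReflect h) 0 = ∫ t, g t * conj (h t) := by
  rw [weilConv_apply]
  congr 1 with u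
  simp [weilReflect]

/-- **Integration by parts for test functions** (the kernel identity at `t = 0`):
`∫ v' conj ψ = −∫ v conj ψ'`. [folklore] -/
theorem integral_deriv_mul_conj (hv : IsWeilTest v) (hψ : IsWeilTest ψ) :
    ∫ t, deriv v t * conj (ψ t) = -∫ t, v t * conj (deriv ψ t) := by
  rw [← weilConv_weilReflect_apply_zero_eq_integral, ← weilConv_weilReflect_apply_zero_eq_integral,
    weilConv_deriv_weilReflect_eq_neg hv hψ]

end Kernel

/-! ## §3. Primitives of window functions -/

section Primitive

variable {a : ℝ} {v : ℝ → ℂ}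

/-- A square-integrable function vanishing a.e. off the window is integrable. [folklore] -/
theorem integrable_of_memLp_two_window (hv : MemLp v 2)
    (hvz : ∀ᵐ t : ℝ, t ∉ Icc (-a) a → v t = 0) : Integrable v := by
  have h1 : IntegrableOn v (Icc (-a) a) := (hv.restrict (Icc (-a) a)).integrable one_le_two
  exact h1.integrable_of_ae_notMem_eq_zero hvz

/-- Lebesgue-almost every real number differs from a given one. [folklore] -/
theorem ae_ne_point (x : ℝ) : ∀ᵐ t : ℝ, t ≠ x := by
  rw [ae_iff]
  simp

/-- `∫_{-a}^{a} v = ∫ v` for `v` vanishing a.e. off `[-a, a]` (`a ≥ 0`). [folklore] -/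
theorem intervalIntegral_window_eq_integral (ha : 0 ≤ a)
    (hvz : ∀ᵐ t : ℝ, t ∉ Icc (-a) a → v t = 0) : ∫ t in (-a)..a, v t = ∫ t, v t := by
  rw [intervalIntegral.integral_of_le (by linarith)]
  apply setIntegral_eq_integral_of_ae_compl_eq_zero
  filter_upwards [hvz, ae_ne_point (-a)] with t ht hta hts
  exact ht fun htI ↦ hts ⟨lt_of_le_of_ne htI.1 (Ne.symm hta), htI.2⟩

/-- The primitive `t ↦ ∫_{-a}^t v` of a function vanishing a.e. off the window vanishes to the
left of the window. [folklore] -/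
theorem primitive_eq_zero_of_le (hvz : ∀ᵐ t : ℝ, t ∉ Icc (-a) a → v t = 0) {t : ℝ}
    (ht : t ≤ -a) : ∫ s in (-a)..t, v s = 0 := by
  apply intervalIntegral.integral_zero_ae
  filter_upwards [hvz, ae_ne_point (-a)] with s hs hsa hsI
  rw [uIoc_of_ge ht] at hsI
  exact hs fun hsw ↦ hsa (le_antisymm hsI.2 hsw.1)

/-- The primitive `t ↦ ∫_{-a}^t v` of an integrable function vanishing a.e. off the window equals
`∫ v` to the right of the window. [folklore] -/
theorem primitive_eq_integral_of_le (ha : 0 ≤ a) (hv : Integrable v)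
    (hvz : ∀ᵐ t : ℝ, t ∉ Icc (-a) a → v t = 0) {t : ℝ} (ht : a ≤ t) :
    ∫ s in (-a)..t, v s = ∫ s, v s := by
  rw [← intervalIntegral.integral_add_adjacent_intervals (b := a) hv.intervalIntegrable
    hv.intervalIntegrable, intervalIntegral_window_eq_integral ha hvz, add_eq_left]
  apply intervalIntegral.integral_zero_ae
  filter_upwards [hvz] with s hs hsI
  rw [uIoc_of_le ht] at hsI
  exact hs fun hsw ↦ by linarith [hsI.1, hsw.2]

/-- `‖∫_s^t v‖ ≤ ∫ ‖v‖` for an integrable `v`. [folklore] -/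
theorem norm_intervalIntegral_le_integral_norm (hv : Integrable v) (s t : ℝ) :
    ‖∫ x in s..t, v x‖ ≤ ∫ x, ‖v x‖ :=
  le_trans intervalIntegral.norm_integral_le_integral_norm_uIoc
    (setIntegral_le_integral hv.norm (ae_of_all _ fun _ ↦ norm_nonneg _))

/-- **Cauchy–Schwarz on the window**: `∫‖v‖ ≤ √(2a) √(∫‖v‖²)` for `v ∈ L²` vanishing a.e. off
`[-a, a]`. [folklore] -/
theorem integral_norm_le_sqrt_window (ha : 0 ≤ a) (hv : MemLp v 2)
    (hvz : ∀ᵐ t : ℝ, t ∉ Icc (-a) a → v t = 0) :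
    ∫ t, ‖v t‖ ≤ √(2 * a) * √(∫ t, ‖v t‖ ^ 2) := by
  set χ : ℝ → ℝ := (Icc (-a) a).indicator fun _ ↦ (1 : ℝ) with hχ
  have h1 : (fun t ↦ ‖v t‖) =ᵐ[volume] fun t ↦ ‖v t‖ * χ t := by
    filter_upwards [hvz] with t ht
    by_cases hm : t ∈ Icc (-a) a
    · simp [hχ, hm]
    · simp [hχ, hm, ht hm]
  rw [integral_congr_ae h1]
  have h2 : ENNReal.ofReal 2 = 2 := by norm_num
  have hA : MemLp (fun t ↦ ‖v t‖) (ENNReal.ofReal 2) volume := by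
    rw [h2]
    exact hv.norm
  have hB : MemLp χ (ENNReal.ofReal 2) volume := by
    rw [h2, hχ]
    exact memLp_indicator_const 2 measurableSet_Icc 1 (Or.inr measure_Icc_lt_top.ne)
  have h := integral_mul_le_Lp_mul_Lq_of_nonneg Real.HolderConjugate.two_two
    (ae_of_all _ fun t ↦ norm_nonneg (v t))
    (ae_of_all _ fun t ↦ Set.indicator_nonneg (fun _ _ ↦ zero_le_one) t) hA hB
  simp only [Real.rpow_two] at h
  have hχ2 : (fun t ↦ χ t ^ 2) = χ := by
    funext t
    by_cases hm : t ∈ Icc (-a) a <;> simp [hχ, hm]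
  rw [hχ2, hχ, integral_indicator_const _ measurableSet_Icc, Real.volume_real_Icc_of_le (by linarith),
    smul_eq_mul, mul_one, show a - -a = 2 * a by ring, mul_comm] at h
  rw [Real.sqrt_eq_rpow, Real.sqrt_eq_rpow]
  exact h

/-- **`L²` smallness of primitives.** For `v ∈ L²` vanishing a.e. off `[-a, a]` (`a > 0`) with
`∫ v = 0`, the primitive `P(t) = ∫_{-a}^t v` vanishes off the window and
`∫ ‖P‖² ≤ 4a² ∫‖v‖²` (`‖P‖ ≤ ∫‖v‖ ≤ √(2a)‖v‖₂` on the window). [folklore] -/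
theorem integral_norm_sq_primitive_le (ha : 0 < a) (hv : MemLp v 2)
    (hvz : ∀ᵐ t : ℝ, t ∉ Icc (-a) a → v t = 0) (hv0 : ∫ t, v t = 0) :
    ∫ t, ‖∫ s in (-a)..t, v s‖ ^ 2 ≤ 4 * a ^ 2 * ∫ t, ‖v t‖ ^ 2 := by
  have hvi : Integrable v := integrable_of_memLp_two_window hv hvz
  set B : ℝ := ∫ t, ‖v t‖ with hBdef
  have hB0 : 0 ≤ B := integral_nonneg fun _ ↦ norm_nonneg _
  have hB : B ≤ √(2 * a) * √(∫ t, ‖v t‖ ^ 2) := integral_norm_le_sqrt_window ha.le hv hvz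
  have hpt : ∀ t, ‖∫ s in (-a)..t, v s‖ ^ 2 ≤ (Icc (-a) a).indicator (fun _ ↦ B ^ 2) t := by
    intro t
    by_cases ht : t ∈ Icc (-a) a
    · rw [indicator_of_mem ht]
      exact pow_le_pow_left₀ (norm_nonneg _) (norm_intervalIntegral_le_integral_norm hvi _ _) 2
    · rw [indicator_of_notMem ht]
      rw [mem_Icc, not_and_or, not_le, not_le] at ht
      rcases ht with h1 | h2
      · rw [primitive_eq_zero_of_le hvz h1.le]
        simp
      · rw [primitive_eq_integral_of_le ha.le hvi hvz h2.le, hv0]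
        simp
  have hint : Integrable ((Icc (-a) a).indicator fun _ ↦ B ^ 2) volume :=
    (integrable_indicator_iff measurableSet_Icc).2
      (continuousOn_const.integrableOn_compact isCompact_Icc)
  have hN0 : 0 ≤ ∫ t, ‖v t‖ ^ 2 := integral_nonneg fun _ ↦ by positivity
  calc ∫ t, ‖∫ s in (-a)..t, v s‖ ^ 2
      ≤ ∫ t, (Icc (-a) a).indicator (fun _ ↦ B ^ 2) t :=
        integral_mono_of_nonneg (ae_of_all _ fun _ ↦ by positivity) hint (ae_of_all _ hpt)
    _ = 2 * a * B ^ 2 := by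
        rw [integral_indicator_const _ measurableSet_Icc, Real.volume_real_Icc_of_le (by linarith),
          smul_eq_mul]
        ring
    _ ≤ 2 * a * (√(2 * a) * √(∫ t, ‖v t‖ ^ 2)) ^ 2 := by gcongr
    _ = 4 * a ^ 2 * ∫ t, ‖v t‖ ^ 2 := by
        rw [mul_pow, Real.sq_sqrt (by positivity), Real.sq_sqrt hN0]
        ring

/-- **`|∫ v| ≤ √(2a) ‖v‖₂`** for `v ∈ L²` vanishing a.e. off `[-a, a]`. [folklore] -/
theorem norm_integral_le_sqrt_window (ha : 0 ≤ a) (hv : MemLp v 2)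
    (hvz : ∀ᵐ t : ℝ, t ∉ Icc (-a) a → v t = 0) :
    ‖∫ t, v t‖ ≤ √(2 * a) * √(∫ t, ‖v t‖ ^ 2) :=
  (norm_integral_le_integral_norm _).trans (integral_norm_le_sqrt_window ha hv hvz)

/-- **The window primitive of a mean-zero window test function.** A test function `g` on
`[-a, a]` with `∫ g = 0` is the derivative of a test function `v` on `[-a, a]`, namely
`v(t) = ∫_{-a}^t g` (`ConnesVanSuijlekom.exists_primitive` at `w = 0`). [folklore] -/
theorem exists_windowPrimitive {g : ℝ → ℂ} (hg : IsWeilTest g) (hgs : tsupport g ⊆ Icc (-a) a)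
    (h0 : ∫ t, g t = 0) :
    ∃ v : ℝ → ℂ, IsWeilTest v ∧ tsupport v ⊆ Icc (-a) a ∧ deriv v = g ∧
      ∀ t, v t = ∫ τ in (-a)..t, g τ := by
  obtain ⟨v, hv, hvs, hd, hv'⟩ := ConnesVanSuijlekom.exists_primitive hg hgs 0 (by simpa using h0)
  refine ⟨v, hv, hvs, funext fun t ↦ by simpa using hd t, fun t ↦ ?_⟩
  simpa using hv' t

end Primitive

end Summit.RiemannHypothesis.RiemannHypothesis.Theorems.GroundStateSimpleEven

namespace Summit.RiemannHypothesis.RiemannHypothesis.Theorems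

open Literature.NumberTheory.LFunctions

set_option linter.dupNamespace false in
/-- **Registered sub-goal of stub INTERTWINE (helper 2): the kernel identity.** For test
functions `v, ψ`: `W(v' ⋆ ψ̃) = −W(v ⋆ (ψ')̃)` — `d/dt` intertwines the translation-invariant
Weil pairing (continuum Connes–van Suijlekom 2025 Lemma 5.1 (5.2), no boundary term;
`GroundStateSimpleEven.weilFunctional_weilConv_deriv_left`). [folklore] -/
theorem stub_intertwine_kernelIdentity :
    ∀ v ψ : ℝ → ℂ, IsWeilTest v → IsWeilTest ψ →
      weilFunctional (weilConv (deriv v) (weilReflect ψ)) =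
        -weilFunctional (weilConv v (weilReflect (deriv ψ))) :=
  fun _ _ hv hψ => GroundStateSimpleEven.weilFunctional_weilConv_deriv_left hv hψ

end Summit.RiemannHypothesis.RiemannHypothesis.Theorems

end
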